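import Summits.KontsevichZagierPeriods.KontsevichZagierPeriods.Theorems.TerasomaMultiplicationCompleteModGammaSectorLegendreSquareCoV
import Summits.KontsevichZagierPeriods.KontsevichZagierPeriods.Theorems.TerasomaMultiplicationCompleteModGammaSectorElliottToCusp
import Summits.KontsevichZagierPeriods.KontsevichZagierPeriods.Theorems.TerasomaMultiplicationCompleteModGammaSectorIntegrateOutU
import Summits.KontsevichZagierPeriods.KontsevichZagierPeriods.Theorems.TerasomaMultiplicationCompleteModGammaSectorHalfPiLink
import Literature.NumberTheory.Transcendental.KZCubeProducts
import Literature.NumberTheory.Transcendental.KZRelationsLE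
import Literature.NumberTheory.Transcendental.KZLogCalculusProofs

/-!
# `CompleteModGammaSector` (stmt-KontsevichZagierPeriods-14233) — line `cusp-transport-to-the-beta-world`,
# third engine client: stub `stub_legendreSector` (assembly of the `LegendreSector` chain)

**Legendre's relation at every real algebraic modulus, as a chain of moves.** For a real algebraic
`m ∈ (0,1)` let `F(m; x, y) = κₘ(x) e_{1−m}(y) + eₘ(x) κ_{1−m}(y) − κₘ(x) κ_{1−m}(y)` be Legendre's
form on the open square (`κₘ(x) = 1/√((1−x²)(1−mx²))`, `eₘ(x) = √(1−mx²)/√(1−x²)`; value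
`E K′ + E′ K − K K′ = π/2`). Then every representation `[(0,1)², F(m; ·)]` is equivalent, in the
Kontsevich–Zagier calculus of moves, to every representation `[ℝ, 1/(2(1+x²))]` (value `π/2`).
This is VERBATIM the body of the crux `GaussManinCertificates.LegendreSector`
(stmt-KontsevichZagierPeriods-3013).

Proof — the four landed links of the chain, composed by `Equivalent.trans`:

* S1 `stub_legendreSquareCoV`: the change of variables `(x, y) ↦ (x², y²)` turns `[(0,1)², F(m;·)]`
  into `R = [(0,1)², ¼ K · (1 − mt − (1−m)u)]`, `K` the Elliott kernel at `a = ½`, `c = 1`;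
* S2 `CompleteModGammaSectorCuspLine.elliottToCusp_smul` at `a = ½`, `c = 1`, `z₁ = m`, `α = ¼`
  (cusp transport in the modulus): `R ∼ ¼·C`, `C = [(0,1)², t^{−1/2}(1−t)^{−1/2}u^{−1/2}]` the
  cusp Beta cube (`KZ.exists_cubeBetaRep` of the data `x = (½, ½)`, `y = (½, 1)`); the product
  form `K · (1 − mt − (1−m)u)` of `R` is converted pointwise to the sum form
  `e k′ + k e′ − k k′` (`e = k · (1 − zt)`, two `Real.rpow_add_one`);
* S3 `stub_integrateOutU`: `C ∼ D = [(0,1), 2 t^{−1/2}(1−t)^{−1/2}]`, hence `¼·C ∼ ¼·D`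
  (`KZ.Equivalent.constMul`);
* S4 `stub_halfPiLink` applied to `¼·D` (integrand `¼ · 2 k = ½ k`): `¼·D ∼ [ℝ, 1/(2(1+x²))]`.

References: M. Kontsevich, D. Zagier, *Periods* (2001), §1.2 (rules of the calculus and the
discussion of Legendre's relation); G. E. Andrews, R. Askey, R. Roy, *Special Functions* (1999),
Thm 3.2.8.
-/

noncomputable section

-- `Summit.KontsevichZagierPeriods.KontsevichZagierPeriods.…` is the tree's mandated layout (single-conjunct summit).
set_option linter.dupNamespace false

namespace Summit.KontsevichZagierPeriods.KontsevichZagierPeriods.CompleteModGammaSectorEngine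

open MeasureTheory Set
open Literature.NumberTheory.Transcendental
open Literature.NumberTheory.Transcendental.KZ
open Summit.KontsevichZagierPeriods.KontsevichZagierPeriods.CompleteModGammaSectorCuspLine
  (elliottToCusp_smul)

/-- `1/4` is algebraic over `ℚ`. [folklore] -/
private theorem isAlgebraic_quarter_legendreSector : IsAlgebraic ℚ (1 / 4 : ℝ) := by
  simpa using isAlgebraic_algebraMap (R := ℚ) (A := ℝ) (1 / 4)

/-- The cusp Beta cube `[(0,1)², t^{−1/2}(1−t)^{−1/2}u^{−1/2}]` exists: it is the cube Beta
representation of the data `x = (½, ½)`, `y = (½, 1)` (`KZ.exists_cubeBetaRep`, `(1−u)^0 = 1`).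
[cite: KontsevichZagier2001, §1.2] -/
private theorem exists_cuspCube_legendreSector :
    ∃ C : IntegralRep 2, C.domain = {x | ∀ i, x i ∈ Set.Ioo (0 : ℝ) 1} ∧
      Set.EqOn C.integrand (fun x : Fin 2 → ℝ => (x 0) ^ (-(1 / 2 : ℝ)) * (1 - x 0) ^ (-(1 / 2 : ℝ)) *
        (x 1) ^ (-(1 / 2 : ℝ))) C.domain := by
  obtain ⟨C, hCd, hCi⟩ := exists_cubeBetaRep (N := 2) ![1 / 2, 1 / 2] ![1 / 2, 1]
    fun j => by fin_cases j <;> norm_num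
  refine ⟨C, hCd, fun x hx => ?_⟩
  rw [hCi hx]
  simp only [Fin.prod_univ_two, Matrix.cons_val_zero, Matrix.cons_val_one]
  have e1 : (((1 / 2 : ℚ)) : ℝ) - 1 = -(1 / 2 : ℝ) := by norm_num
  have e2 : (((1 : ℚ)) : ℝ) - 1 = (0 : ℝ) := by norm_num
  rw [e1, e2, Real.rpow_zero, mul_one]

/-- **Registered stub `stub_legendreSector`** (line `cusp-transport-to-the-beta-world` of crux
stmt-KontsevichZagierPeriods-14233; verbatim the body of `GaussManinCertificates.LegendreSector`,
stmt-KontsevichZagierPeriods-3013): Legendre's relation `E K′ + E′ K − K K′ = π/2` at every real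
algebraic modulus `m ∈ (0,1)` as a chain of moves of the Kontsevich–Zagier calculus —
`[(0,1)², F(m;·)] ∼ [(0,1)², ¼ K(1 − mt − (1−m)u)]` (S1, square change of variables)
`∼ ¼·[(0,1)², t^{−1/2}(1−t)^{−1/2}u^{−1/2}]` (S2, cusp transport in the modulus)
`∼ ¼·[(0,1), 2t^{−1/2}(1−t)^{−1/2}]` (S3, integrating out `u`, scaled)
`∼ [ℝ, 1/(2(1+x²))]` (S4, the half-`π` link). [cite: KontsevichZagier2001, §1.2] -/
theorem stub_legendreSector : ∀ (F : ℝ → (Fin 2 → ℝ) → ℝ), (∀ (m : ℝ) (x : Fin 2 → ℝ), F m x = 1 / Real.sqrt ((1 - x 0 ^ 2) * (1 - m * x 0 ^ 2)) * (Real.sqrt (1 - (1 - m) * x 1 ^ 2) / Real.sqrt (1 - x 1 ^ 2)) + Real.sqrt (1 - m * x 0 ^ 2) / Real.sqrt (1 - x 0 ^ 2) * (1 / Real.sqrt ((1 - x 1 ^ 2) * (1 - (1 - m) * x 1 ^ 2))) - 1 / Real.sqrt ((1 - x 0 ^ 2) * (1 - m * x 0 ^ 2)) * (1 / Real.sqrt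 ((1 - x 1 ^ 2) * (1 - (1 - m) * x 1 ^ 2)))) → ∀ (m : ℝ), IsAlgebraic ℚ m → m ∈ Set.Ioo (0 : ℝ) 1 → ∀ (r : IntegralRep 2) (r' : IntegralRep 1), r.domain = {x | ∀ i, x i ∈ Set.Ioo (0 : ℝ) 1} → Set.EqOn r.integrand (F m) r.domain → r'.domain = Set.univ → Set.EqOn r'.integrand (fun x => 1 / (2 * (1 + x 0 ^ 2))) r'.domain → Equivalent r r' := by
  intro F hF m hma hm r r' hrd hri hr'd hr'i
  -- S1: the square change of variables
  obtain ⟨R, hRd, hRi, hrR⟩ := stub_legendreSquareCoV F hF m hma hm r hrd hri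
  -- the cusp Beta cube `C`
  obtain ⟨C, hCd, hCi⟩ := exists_cuspCube_legendreSector
  -- casts of the rational exponents `a = ½`, `c = 1`
  have ea : ((1 / 2 : ℚ) : ℝ) = 1 / 2 := by norm_num
  have ec : ((1 : ℚ) : ℝ) = 1 := by norm_num
  have e12 : (1 : ℝ) + 1 / 2 - 2 = -(1 / 2 : ℝ) := by norm_num
  have e11 : (1 : ℝ) - 1 = 0 := by norm_num
  -- S2: cusp transport in the modulus, `R ∼ ¼·C`
  have hRC : Equivalent R (C.constMul (1 / 4) isAlgebraic_quarter_legendreSector) := by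
    refine elliottToCusp_smul (1 / 2) 1 m (1 / 4) (by norm_num) (by norm_num) (by norm_num) hm.1
      hm.2 hma isAlgebraic_quarter_legendreSector R _ hRd (fun x hx => ?_)
      (by rw [IntegralRep.domain_constMul, hCd]) (fun x hx => ?_)
    · -- the product form `¼ K (1 − mt − (1−m)u)` is the sum form `¼ (e k′ + k e′ − k k′)`
      rw [hRi hx]
      rw [hRd] at hx
      have hx0 := hx 0
      have hx1 := hx 1
      have h1t : 0 < 1 - m * x 0 := by nlinarith [hx0.1, hx0.2, hm.1, hm.2]
      have h1u : 0 < 1 - (1 - m) * x 1 := by nlinarith [hx1.1, hx1.2, hm.1, hm.2]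
      simp only [ea, ec, e12]
      have e1 : (1 - m * x 0) ^ (1 - (1 / 2 : ℝ)) = (1 - m * x 0) ^ (-(1 / 2 : ℝ)) * (1 - m * x 0) := by
        rw [← Real.rpow_add_one h1t.ne']
        congr 1
        ring
      have e2 : (1 - (1 - m) * x 1) ^ (1 - (1 / 2 : ℝ)) =
          (1 - (1 - m) * x 1) ^ (-(1 / 2 : ℝ)) * (1 - (1 - m) * x 1) := by
        rw [← Real.rpow_add_one h1u.ne']
        congr 1
        ring
      rw [e1, e2]
      ring
    · -- `¼·C` is the scaled cusp cube with `a = ½`, `c = 1`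
      have hx' : x ∈ C.domain := by simpa using hx
      rw [IntegralRep.integrand_constMul]
      dsimp only
      rw [hCi hx']
      simp only [ea, ec, e12, e11, Real.rpow_zero, mul_one]
  -- S3: integrating out `u`, `C ∼ D`, scaled by `¼`
  obtain ⟨D, hDd, hDi, hCD⟩ := stub_integrateOutU C hCd hCi
  have hCD' : Equivalent (C.constMul (1 / 4) isAlgebraic_quarter_legendreSector)
      (D.constMul (1 / 4) isAlgebraic_quarter_legendreSector) :=
    hCD.constMul (1 / 4) isAlgebraic_quarter_legendreSector
  -- S4: the half-`π` link, applied to `¼·D = [(0,1), ½ t^{−1/2}(1−t)^{−1/2}]`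
  have hDr' : Equivalent (D.constMul (1 / 4) isAlgebraic_quarter_legendreSector) r' := by
    refine stub_halfPiLink _ r' (by rw [IntegralRep.domain_constMul, hDd]) (fun x hx => ?_) hr'd hr'i
    have hx' : x ∈ D.domain := by simpa using hx
    rw [IntegralRep.integrand_constMul]
    dsimp only
    rw [hDi hx']
    ring
  exact hrR.trans (hRC.trans (hCD'.trans hDr'))

end Summit.KontsevichZagierPeriods.KontsevichZagierPeriods.CompleteModGammaSectorEngine

end
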